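import Literature.Probability.LatticeModels.PointwiseScalingLimitEtaExists
import Literature.Probability.LatticeModels.CriticalTwoPointDCPLowerHolds
import HarnessLib

/-!
# Crux `TwoPointDoubling` (stmt-CriticalPhenomena-6150), birth line — stub `stub_leanScalePropagation`:
# doubling of the critical axial two-point function propagates through LEAN windows

Line `birth` of crux `TwoPointDoubling` (`Cruxes/TwoPointDoubling/Lines/birth.lean`, route
`MirrorHoelderCompactness`; the crux is item stmt-CriticalPhenomena-6150, which is also the engine
`stub_wallRepulsion` ⟺ 6150 of line `folded-current-repulsion` of crux stmt-CriticalPhenomena-1981).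
This file proves the registered stub `stub_leanScalePropagation` EXACTLY as registered:

for every threshold `A > 0` there is `κ > 0` such that `κ·g(n) ≤ g(2n)` for every `n ≥ 1` all of whose
scales `1 ≤ k ≤ 8n` are *A-lean*, `g(k) ≤ A·k^(−3/2)`; here `g(k) = ⟨σ₀σ_{k e₀}⟩⁺_{β_c(3)} =
criticalTwoPoint 3 (Pi.single 0 k)`.

Proof (Duminil-Copin–Panis 2025, Theorem 1.3 at `d = 3`, `β = β_c`, which is PROVED in the tree:
`dcp_criticalTwoPoint_axis_lower_holds`): for `2n ≥ N₁`,
`g(2n) ≥ c₁ / (χ_{8n} + 2n·Σ_{k ≤ 4n} k g(k))` with `χ_{8n} = Σ_{x ∈ Λ_{8n}} ⟨σ₀σ_x⟩`. On an A-lean window,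
Messager–Miracle-Solé in the sup norm (`⟨σ₀σ_x⟩ ≤ g(‖x‖_∞)`, `criticalTwoPoint_axis_sandwich`) and the
shell count `|∂Λ_m| ≤ 6(2m+1)²` give `χ_{8n} ≤ 1 + 54·A·(8n)·√(8n) ≤ 1 + 1296·A·n√n`, and
`Σ_{k ≤ 4n} k·g(k) ≤ A Σ_{k ≤ 4n} 1/√k ≤ 4A√n` (telescoping); so the denominator is `≤ (1 + 1304 A)·n√n`, while
leanness at `k = n` reads `g(n)·n√n ≤ A`. Hence `g(2n) ≥ (c₁/(A(1 + 1304 A)))·g(n)`. For `2n < N₁`,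
`g(2n) ≥ g(N₁) ≥ g(N₁)·g(n)` by axis monotonicity and `g ≤ 1`. So `κ = min (c₁/(A(1+1304A))) (g N₁)`.

## References

* H. Duminil-Copin, R. Panis, *New lower bounds for the (near) critical Ising and φ⁴ models' two-point
  functions*, Comm. Math. Phys. 406 (2025), arXiv:2404.05700, Theorem 1.3 [DuminilCopinPanis2025LowerBounds].
* A. Messager, S. Miracle-Solé, J. Stat. Phys. 17 (1977) 245 [MessagerMiracleSoleJSP1977].
* M. Aizenman, H. Duminil-Copin, Ann. of Math. 194 (2021), arXiv:1912.07973, Remark 5.10 (the crux)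
  [AizenmanDuminilCopinAnnals2021].
-/

noncomputable section

namespace Summit.CriticalPhenomena.Ising3DConformalLimit.Cruxes.TwoPointDoubling.Birth

open scoped BigOperators
open Finset Literature.Probability.LatticeModels

/-! ## Real-variable lemmas -/

/-- `k^(−3/2) = 1/(k√k)` for a natural number `k ≥ 1`. [folklore] -/
theorem rpow_neg_three_halves_eq (k : ℕ) (hk : 1 ≤ k) :
    (k : ℝ) ^ (-(3 : ℝ) / 2) = 1 / ((k : ℝ) * Real.sqrt k) := by
  have hk0 : (0 : ℝ) < k := by exact_mod_cast hk
  rw [show (-(3 : ℝ) / 2) = -((1 : ℝ) + 1 / 2) by norm_num, Real.rpow_neg hk0.le,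
    Real.rpow_add hk0, Real.rpow_one, ← Real.sqrt_eq_rpow, one_div]

/-! ## Lattice sums: shells of the box in `ℤ³` -/

/-- `Σ_{Λ_{k+1}} F = Σ_{Λ_k} F + Σ_{∂Λ_{k+1}} F`. [folklore] -/
theorem sum_box_succ (F : Site 3 → ℝ) (k : ℕ) :
    ∑ x ∈ box 3 (k + 1), F x = ∑ x ∈ box 3 k, F x + ∑ x ∈ sphere 3 (k + 1), F x := by
  have hsub : box 3 k ⊆ box 3 (k + 1) := box_mono 3 (Nat.le_succ k)
  rw [sphere_succ_eq_sdiff, ← Finset.sum_sdiff hsub]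
  exact add_comm _ _

/-- Shell bound: if `F ≤ B` on `∂Λ_{k+1}` with `B ≥ 0` then `Σ_{∂Λ_{k+1}} F ≤ 6(2k+3)²·B`
(`|∂Λ_{k+1}| ≤ 2·3·(2k+3)²`, `card_sphere_succ_le`). [folklore] -/
theorem sum_sphere_le (F : Site 3 → ℝ) (k : ℕ) {B : ℝ} (hB0 : 0 ≤ B)
    (hB : ∀ x : Site 3, Site.supNorm x = k + 1 → F x ≤ B) :
    ∑ x ∈ sphere 3 (k + 1), F x ≤ 6 * (2 * k + 3 : ℝ) ^ 2 * B := by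
  calc ∑ x ∈ sphere 3 (k + 1), F x ≤ ∑ _x ∈ sphere 3 (k + 1), B :=
        Finset.sum_le_sum fun x hx => hB x (mem_sphere.1 hx)
    _ = (#(sphere 3 (k + 1)) : ℝ) * B := by rw [Finset.sum_const, nsmul_eq_mul]
    _ ≤ 6 * (2 * k + 3 : ℝ) ^ 2 * B := by
        refine mul_le_mul_of_nonneg_right ?_ hB0
        have h := card_sphere_succ_le (d := 3) k
        norm_num at h
        linarith

/-! ## The two denominators of Duminil-Copin–Panis on an `A`-lean window -/

/-- **Susceptibility on a lean window.** If `g(k) ≤ A k^(−3/2)` for `1 ≤ k ≤ M`, then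
`χ_M = Σ_{x ∈ Λ_M} ⟨σ₀σ_x⟩_{β_c} ≤ 1 + 54·A·M·√M` (MMS in the sup norm + shell counting).
[cite: MessagerMiracleSoleJSP1977, main theorem (monotonicity of ⟨σ₀σ_x⟩ under reflections)] -/
theorem sum_box_le_of_lean {A : ℝ} (hA : 0 ≤ A) (M : ℕ)
    (hlean : ∀ k : ℕ, 1 ≤ k → k ≤ M →
      criticalTwoPoint 3 (Pi.single 0 (k : ℤ)) ≤ A * (k : ℝ) ^ (-(3 : ℝ) / 2)) :
    ∑ x ∈ box 3 M, criticalTwoPoint 3 x ≤ 1 + 54 * A * M * Real.sqrt M := by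
  induction M with
  | zero =>
    have h0 : box 3 0 = {0} := by
      ext x
      simp only [mem_box_iff_supNorm_le, Nat.le_zero, Site.supNorm_eq_zero_iff, Finset.mem_singleton]
    simp [h0, criticalTwoPoint_zero']
  | succ M ih =>
    have ih' := ih fun k hk hkM => hlean k hk (Nat.le_succ_of_le hkM)
    rw [sum_box_succ]
    -- on the shell `‖x‖_∞ = M+1`: `⟨σ₀σ_x⟩ ≤ g(M+1) ≤ A (M+1)^(-3/2) = A/((M+1)√(M+1))`
    have hM1 : (1 : ℕ) ≤ M + 1 := by omega
    have hpos : (0 : ℝ) < (M : ℝ) + 1 := by positivity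
    have hsq : 0 < Real.sqrt ((M : ℝ) + 1) := Real.sqrt_pos.2 hpos
    have hsq2 : Real.sqrt ((M : ℝ) + 1) ^ 2 = (M : ℝ) + 1 := Real.sq_sqrt hpos.le
    set den : ℝ := ((M : ℝ) + 1) * Real.sqrt ((M : ℝ) + 1) with hden_def
    have hden : 0 < den := by positivity
    set B : ℝ := A * (1 / den) with hBdef
    have hB0 : 0 ≤ B := by positivity
    have hshell : ∀ x : Site 3, Site.supNorm x = M + 1 → criticalTwoPoint 3 x ≤ B := by
      intro x hx
      have h1 := (criticalTwoPoint_axis_sandwich (y := x) (by omega)).2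
      rw [hx] at h1
      have h2 := hlean (M + 1) hM1 le_rfl
      rw [rpow_neg_three_halves_eq (M + 1) hM1] at h2
      push_cast at h1 h2
      exact h1.trans h2
    have hS := sum_sphere_le (criticalTwoPoint 3) M hB0 hshell
    -- arithmetic: `54 A M √M + 6 (2M+3)² B ≤ 54 A (M+1) √(M+1)`
    have hsqrt_mono : Real.sqrt (M : ℝ) ≤ Real.sqrt ((M : ℝ) + 1) :=
      Real.sqrt_le_sqrt (by linarith)
    have hshellB : 6 * (2 * M + 3 : ℝ) ^ 2 * B ≤ 54 * A * Real.sqrt ((M : ℝ) + 1) := by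
      -- `(2M+3)² ≤ 9 (M+1)²` and `B = A /((M+1)√(M+1))`
      have h9 : (2 * M + 3 : ℝ) ^ 2 ≤ 9 * ((M : ℝ) + 1) ^ 2 := by nlinarith
      have hrhs : 54 * A * Real.sqrt ((M : ℝ) + 1) * den = 54 * A * ((M : ℝ) + 1) ^ 2 := by
        have hss : Real.sqrt ((M : ℝ) + 1) * Real.sqrt ((M : ℝ) + 1) = (M : ℝ) + 1 :=
          Real.mul_self_sqrt hpos.le
        calc 54 * A * Real.sqrt ((M : ℝ) + 1) * den
            = 54 * A * ((M : ℝ) + 1) * (Real.sqrt ((M : ℝ) + 1) * Real.sqrt ((M : ℝ) + 1)) := by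
              rw [hden_def]; ring
          _ = 54 * A * ((M : ℝ) + 1) ^ 2 := by rw [hss]; ring
      rw [hBdef, show 6 * (2 * M + 3 : ℝ) ^ 2 * (A * (1 / den)) = 6 * (2 * M + 3 : ℝ) ^ 2 * A / den by ring,
        div_le_iff₀ hden, hrhs]
      have h6 := mul_le_mul_of_nonneg_left h9 (by positivity : (0 : ℝ) ≤ 6 * A)
      nlinarith [h6]
    have hmain : 54 * A * M * Real.sqrt M + 6 * (2 * M + 3 : ℝ) ^ 2 * B ≤
        54 * A * ((M : ℝ) + 1) * Real.sqrt ((M : ℝ) + 1) := by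
      have h1 : 54 * A * M * Real.sqrt M ≤ 54 * A * M * Real.sqrt ((M : ℝ) + 1) :=
        mul_le_mul_of_nonneg_left hsqrt_mono (by positivity)
      nlinarith [h1, hshellB]
    push_cast
    linarith [ih', hS, hmain]

/-- **Weighted axial sum on a lean window.** If `g(k) ≤ A k^(−3/2)` for `1 ≤ k ≤ K`, then
`Σ_{k=1}^{K} k·g(k) ≤ 2A√K`. [folklore] -/
theorem sum_axis_le_of_lean {A : ℝ} (hA : 0 ≤ A) (K : ℕ)
    (hlean : ∀ k : ℕ, 1 ≤ k → k ≤ K →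
      criticalTwoPoint 3 (Pi.single 0 (k : ℤ)) ≤ A * (k : ℝ) ^ (-(3 : ℝ) / 2)) :
    ∑ k ∈ Finset.Icc 1 K, (k : ℝ) * criticalTwoPoint 3 (Pi.single 0 (k : ℤ)) ≤
      2 * A * Real.sqrt K := by
  -- `Σ_{k=1}^{K} 1/√k ≤ 2√K` (telescoping: `1/√(j+1) ≤ 2√(j+1) − 2√j`); this elementary bound is also
  -- `Literature.NumberTheory.LFunctions.sum_Icc_one_div_sqrt_le`, kept local here to avoid importing the
  -- L-function files into the lattice-model cone.
  have hsqrtSum : ∑ k ∈ Finset.Icc 1 K, 1 / Real.sqrt k ≤ 2 * Real.sqrt K := by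
    clear hlean
    induction K with
    | zero => simp
    | succ K ih =>
      rw [Finset.sum_Icc_succ_top (by omega), Nat.cast_succ]
      have hs : 0 ≤ Real.sqrt K := Real.sqrt_nonneg _
      have ht : 0 < Real.sqrt ((K : ℝ) + 1) := Real.sqrt_pos.2 (by positivity)
      have hs2 : Real.sqrt K ^ 2 = (K : ℝ) := Real.sq_sqrt (by positivity)
      have ht2 : Real.sqrt ((K : ℝ) + 1) ^ 2 = (K : ℝ) + 1 := Real.sq_sqrt (by positivity)
      have key : 2 * Real.sqrt K * Real.sqrt ((K : ℝ) + 1) + 1 ≤ 2 * ((K : ℝ) + 1) := by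
        nlinarith [sq_nonneg (Real.sqrt ((K : ℝ) + 1) - Real.sqrt K)]
      have h1 : 1 / Real.sqrt ((K : ℝ) + 1) ≤ 2 * Real.sqrt ((K : ℝ) + 1) - 2 * Real.sqrt K := by
        rw [div_le_iff₀ ht]
        nlinarith [key, ht2]
      linarith
  calc ∑ k ∈ Finset.Icc 1 K, (k : ℝ) * criticalTwoPoint 3 (Pi.single 0 (k : ℤ))
      ≤ ∑ k ∈ Finset.Icc 1 K, A * (1 / Real.sqrt k) := by
        refine Finset.sum_le_sum fun k hk => ?_
        rw [Finset.mem_Icc] at hk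
        have hk0 : (0 : ℝ) < k := by exact_mod_cast hk.1
        have h := hlean k hk.1 hk.2
        rw [rpow_neg_three_halves_eq k hk.1] at h
        have hsk : 0 < Real.sqrt k := Real.sqrt_pos.2 hk0
        calc (k : ℝ) * criticalTwoPoint 3 (Pi.single 0 (k : ℤ))
            ≤ (k : ℝ) * (A * (1 / ((k : ℝ) * Real.sqrt k))) :=
              mul_le_mul_of_nonneg_left h hk0.le
          _ = A * (1 / Real.sqrt k) := by field_simp
    _ = A * ∑ k ∈ Finset.Icc 1 K, 1 / Real.sqrt k := by rw [Finset.mul_sum]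
    _ ≤ A * (2 * Real.sqrt K) := mul_le_mul_of_nonneg_left hsqrtSum hA
    _ = 2 * A * Real.sqrt K := by ring

/-! ## Duminil-Copin–Panis, Theorem 1.3 at `d = 3`, in the plus state -/

/-- **DCP Theorem 1.3 at `β_c(3)` for the plus state**: there are `c₁ > 0` and `N₁` with
`c₁ / (χ_{4m} + m Σ_{k ≤ 2m} k g(k)) ≤ g(m)` for all `m ≥ N₁`, `g`, `χ` taken in the plus state
(`= ` free state at `β_c`, `twoPointPlus_criticalBeta_eq_twoPointFree_holds`).
[cite: DuminilCopinPanis2025LowerBounds, Theorem 1.3] -/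
theorem dcp_axis_lower_three :
    ∃ c₁ : ℝ, 0 < c₁ ∧ ∃ N₁ : ℕ, 0 < N₁ ∧ ∀ m : ℕ, N₁ ≤ m →
      c₁ / ((∑ x ∈ box 3 (4 * m), criticalTwoPoint 3 x) +
          (m : ℝ) * ∑ k ∈ Finset.Icc 1 (2 * m), (k : ℝ) * criticalTwoPoint 3 (Pi.single 0 (k : ℤ)))
        ≤ criticalTwoPoint 3 (Pi.single 0 (m : ℤ)) := by
  obtain ⟨c₁, hc₁, N₁, hN₁, h⟩ := dcp_criticalTwoPoint_axis_lower_holds (d := 3) le_rfl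
  have hGF : twoPointFree 3 (criticalBeta 3) = criticalTwoPoint 3 :=
    funext fun x => (twoPointPlus_criticalBeta_eq_twoPointFree_holds (d := 3) le_rfl x).symm
  have e0 : (⟨0, by omega⟩ : Fin 3) = 0 := rfl
  refine ⟨c₁, hc₁, N₁, hN₁, fun m hm => ?_⟩
  have h' := h m hm
  rw [hGF, e0, show (3 : ℕ) - 2 = 1 from rfl, pow_one] at h'
  exact h'

/-! ## The stub -/

/-- **STUB `stub_leanScalePropagation` of the birth line of crux `TwoPointDoubling` (item
stmt-CriticalPhenomena-6150) — doubling propagates through LEAN windows.** For every threshold `A > 0`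
there is `κ > 0` such that `κ·g(n) ≤ g(2n)` for every `n ≥ 1` all of whose scales `1 ≤ k ≤ 8n` satisfy
`g(k) ≤ A·k^(−3/2)`; `g(k) = criticalTwoPoint 3 (Pi.single 0 k)`. Route: Duminil-Copin–Panis Thm 1.3 at
`d = 3`, `β = β_c` (`g(2n) ≥ c₁/(χ_{8n} + 2n Σ_{k≤4n} k g(k))`, `2n ≥ N₁`) + sup-norm MMS to bound the
denominator by `(1 + 1304 A) n√n` on an A-lean window + leanness at `k = n`; small `n` by positivity and
axis monotonicity. [cite: DuminilCopinPanis2025LowerBounds, Theorem 1.3]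
[cite: AizenmanDuminilCopinAnnals2021, arXiv:1912.07973 Remark 5.10] -/
theorem stub_leanScalePropagation :
    ∀ A : ℝ, 0 < A → ∃ κ : ℝ, 0 < κ ∧ ∀ n : ℕ, 1 ≤ n →
      (∀ k : ℕ, 1 ≤ k → k ≤ 8 * n →
        Literature.Probability.LatticeModels.criticalTwoPoint 3 (Pi.single 0 (k : ℤ)) ≤ A * (k : ℝ) ^ (-(3 : ℝ) / 2)) →
      κ * Literature.Probability.LatticeModels.criticalTwoPoint 3 (Pi.single 0 (n : ℤ)) ≤
        Literature.Probability.LatticeModels.criticalTwoPoint 3 (Pi.single 0 (2 * (n : ℤ))) := by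
  intro A hA
  obtain ⟨c₁, hc₁, N₁, hN₁, hdcp⟩ := dcp_axis_lower_three
  set g : ℕ → ℝ := fun m => criticalTwoPoint 3 (Pi.single 0 (m : ℤ)) with hg
  have hgpos : ∀ m, 0 < g m := fun m => criticalTwoPoint_axis_pos m
  have hgle : ∀ m, g m ≤ 1 := fun m => criticalTwoPoint_le_one' _
  have hanti : Antitone g := criticalTwoPoint_axis_antitone
  -- the two constants
  set κ₁ : ℝ := c₁ / (A * (1 + 1304 * A)) with hκ₁
  have hκ₁pos : 0 < κ₁ := by positivity
  refine ⟨min κ₁ (g N₁), lt_min hκ₁pos (hgpos N₁), fun n hn hlean => ?_⟩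
  have hcast : (Pi.single 0 (2 * (n : ℤ)) : Site 3) = Pi.single 0 ((2 * n : ℕ) : ℤ) := by
    norm_cast
  rw [hcast]
  change min κ₁ (g N₁) * g n ≤ g (2 * n)
  by_cases hsmall : 2 * n < N₁
  · -- small scales: `g(2n) ≥ g(N₁) ≥ g(N₁) g(n)`
    calc min κ₁ (g N₁) * g n ≤ g N₁ * g n :=
          mul_le_mul_of_nonneg_right (min_le_right _ _) (hgpos n).le
      _ ≤ g N₁ * 1 := mul_le_mul_of_nonneg_left (hgle n) (hgpos N₁).le
      _ = g N₁ := mul_one _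
      _ ≤ g (2 * n) := hanti hsmall.le
  · -- large scales: DCP at scale `2n`
    push Not at hsmall
    have hD := hdcp (2 * n) hsmall
    have e8 : 4 * (2 * n) = 8 * n := by ring
    have e4 : 2 * (2 * n) = 4 * n := by ring
    rw [e8, e4] at hD
    -- bounds on the two pieces of the denominator
    have hχ := sum_box_le_of_lean hA.le (8 * n) hlean
    have hax := sum_axis_le_of_lean hA.le (4 * n) fun k hk hk4 => hlean k hk (by omega)
    have hn1 : (1 : ℝ) ≤ n := by exact_mod_cast hn
    have hn0 : (0 : ℝ) < n := by linarith
    have hsn : 1 ≤ Real.sqrt n := by rw [← Real.sqrt_one]; exact Real.sqrt_le_sqrt hn1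
    have hsn0 : 0 < Real.sqrt n := by linarith
    have hs8 : Real.sqrt ((8 * n : ℕ) : ℝ) ≤ 3 * Real.sqrt n := by
      push_cast
      rw [show (3 : ℝ) = Real.sqrt 9 by rw [show (9:ℝ) = 3 ^ 2 by norm_num, Real.sqrt_sq (by norm_num)],
        ← Real.sqrt_mul (by norm_num)]
      exact Real.sqrt_le_sqrt (by linarith)
    have hs4 : Real.sqrt ((4 * n : ℕ) : ℝ) = 2 * Real.sqrt n := by
      push_cast
      rw [Real.sqrt_mul (by norm_num), show (4:ℝ) = 2 ^ 2 by norm_num, Real.sqrt_sq (by norm_num)]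
    -- the denominator `D` and its bound `D ≤ (1 + 1304 A) n √n`
    set D : ℝ := (∑ x ∈ box 3 (8 * n), criticalTwoPoint 3 x) +
        ((2 * n : ℕ) : ℝ) * ∑ k ∈ Finset.Icc 1 (4 * n), (k : ℝ) * criticalTwoPoint 3 (Pi.single 0 (k : ℤ))
      with hDdef
    have hDle : D ≤ (1 + 1304 * A) * ((n : ℝ) * Real.sqrt n) := by
      have h1 : ∑ x ∈ box 3 (8 * n), criticalTwoPoint 3 x ≤ 1 + 1296 * A * ((n : ℝ) * Real.sqrt n) := by
        refine hχ.trans ?_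
        push_cast at hs8 ⊢
        have : 54 * A * (8 * (n : ℝ)) * Real.sqrt (8 * (n : ℝ)) ≤ 54 * A * (8 * (n : ℝ)) * (3 * Real.sqrt n) :=
          mul_le_mul_of_nonneg_left hs8 (by positivity)
        nlinarith [this]
      have h2 : ((2 * n : ℕ) : ℝ) * ∑ k ∈ Finset.Icc 1 (4 * n), (k : ℝ) * criticalTwoPoint 3 (Pi.single 0 (k : ℤ))
          ≤ 8 * A * ((n : ℝ) * Real.sqrt n) := by
        rw [hs4] at hax
        push_cast
        calc 2 * (n : ℝ) * ∑ k ∈ Finset.Icc 1 (4 * n), (k : ℝ) * criticalTwoPoint 3 (Pi.single 0 (k : ℤ))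
            ≤ 2 * (n : ℝ) * (2 * A * (2 * Real.sqrt n)) :=
              mul_le_mul_of_nonneg_left hax (by positivity)
          _ = 8 * A * ((n : ℝ) * Real.sqrt n) := by ring
      have h3 : (1 : ℝ) ≤ (n : ℝ) * Real.sqrt n := by
        nlinarith [mul_nonneg (sub_nonneg.2 hn1) (sub_nonneg.2 hsn)]
      calc D ≤ 1 + 1296 * A * ((n : ℝ) * Real.sqrt n) + 8 * A * ((n : ℝ) * Real.sqrt n) := add_le_add h1 h2
        _ ≤ (1 + 1304 * A) * ((n : ℝ) * Real.sqrt n) := by nlinarith [h3]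
    have hDpos : 0 < D := by
      have h0 : 0 < ∑ x ∈ box 3 (8 * n), criticalTwoPoint 3 x := by
        have hmem : (0 : Site 3) ∈ box 3 (8 * n) := zero_mem_box 3 _
        calc (0 : ℝ) < criticalTwoPoint 3 0 := by rw [criticalTwoPoint_zero']; exact one_pos
          _ ≤ ∑ x ∈ box 3 (8 * n), criticalTwoPoint 3 x :=
              Finset.single_le_sum (fun x _ => criticalTwoPoint_nonneg' x) hmem
      have h0' : 0 ≤ ((2 * n : ℕ) : ℝ) *
          ∑ k ∈ Finset.Icc 1 (4 * n), (k : ℝ) * criticalTwoPoint 3 (Pi.single 0 (k : ℤ)) :=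
        mul_nonneg (by positivity)
          (Finset.sum_nonneg fun k _ => mul_nonneg (by positivity) (criticalTwoPoint_nonneg' _))
      linarith
    -- `g(2n) ≥ c₁ / D ≥ c₁ / ((1 + 1304 A) n√n)`
    have hg2n : c₁ / ((1 + 1304 * A) * ((n : ℝ) * Real.sqrt n)) ≤ g (2 * n) :=
      (div_le_div_of_nonneg_left hc₁.le hDpos hDle).trans hD
    -- leanness at `k = n`: `g(n) · n√n ≤ A`
    have hln := hlean n hn (by omega)
    rw [rpow_neg_three_halves_eq n hn] at hln
    have hgn : g n * ((n : ℝ) * Real.sqrt n) ≤ A := by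
      have hden : 0 < (n : ℝ) * Real.sqrt n := by positivity
      have hln' : g n ≤ A / ((n : ℝ) * Real.sqrt n) := by simpa only [mul_one_div] using hln
      exact (le_div_iff₀ hden).1 hln'
    -- conclude
    calc min κ₁ (g N₁) * g n ≤ κ₁ * g n :=
          mul_le_mul_of_nonneg_right (min_le_left _ _) (hgpos n).le
      _ ≤ c₁ / ((1 + 1304 * A) * ((n : ℝ) * Real.sqrt n)) := by
          rw [hκ₁]
          have hpos1 : 0 < A * (1 + 1304 * A) := by positivity
          have hpos2 : 0 < (1 + 1304 * A) * ((n : ℝ) * Real.sqrt n) := by positivity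
          rw [div_mul_eq_mul_div, div_le_div_iff₀ hpos1 hpos2]
          have : c₁ * g n * ((1 + 1304 * A) * ((n : ℝ) * Real.sqrt n)) =
              c₁ * (1 + 1304 * A) * (g n * ((n : ℝ) * Real.sqrt n)) := by ring
          rw [this]
          have hc : 0 ≤ c₁ * (1 + 1304 * A) := by positivity
          calc c₁ * (1 + 1304 * A) * (g n * ((n : ℝ) * Real.sqrt n)) ≤ c₁ * (1 + 1304 * A) * A :=
                mul_le_mul_of_nonneg_left hgn hc
            _ = c₁ * (A * (1 + 1304 * A)) := by ring
      _ ≤ g (2 * n) := hg2n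

end Summit.CriticalPhenomena.Ising3DConformalLimit.Cruxes.TwoPointDoubling.Birth

end
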